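import Summits.MatrixMultiplication.MatrixMultiplication.Theorems.AbelianSTPPCensusTB4StatDefs

/-!
# T_B static certificate, range `5591 … 5994` (t*-indexed linear checker with the k-member tree at `τ = 2375/1000`): kernel evaluation, the completeness of the bucket lists, volumes `5801 … (chunk starting 5901)` (small volume chunks: the kernel recursion through the long low-`t` lists is bounded per theorem)

Cell mm-stpp (rung F-M1), tier T_B = «beat `2.375` (Coppersmith–Winograd)»; checker in `AbelianSTPPCensusTB4StatDefs.lean`, table and bucket lists in `AbelianSTPPCensusTB4StatData.lean`
(pattern: theory g12's `AbelianSTPPCensusTAStatDDom*/DCk*.lean`).  `decide` with kernel reduction (standard axioms; no `native_decide`), `Elab.async false`;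
consumed by `TB4Stat.checkV_sound` / `TB4Stat.domV_sound` / `TB4Stat.m2V_sound` in the leaf `AbelianSTPPCensusLeafTB5994Closed.lean`.
WHAT THIS IS NOT: arithmetic on shape lists only; no statement about STPP families or `ω`.
-/

set_option linter.dupNamespace false
set_option autoImplicit false
set_option Elab.async false

namespace Summit.MatrixMultiplication.MatrixMultiplication.Theorems.TB4Stat

set_option maxHeartbeats 0 in
/-- Completeness chunk: every sorted candidate shape of the volumes `5801 … 5900` lies in the list of the bucket of its `a·b` (314 shapes). [original] -/
theorem m2c5801 : TB4Stat.m2V 100 5801 = true := by decide +kernel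

set_option maxHeartbeats 0 in
/-- Completeness chunk: every sorted candidate shape of the volumes `5901 … 5994` lies in the list of the bucket of its `a·b` (85 shapes). [original] -/
theorem m2c5901 : TB4Stat.m2V 94 5901 = true := by decide +kernel

end Summit.MatrixMultiplication.MatrixMultiplication.Theorems.TB4Stat
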